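import Summits.RiemannHypothesis.RiemannHypothesis.Theorems.HardyZLehmerSplitDictionarystub_partialFraction
import Literature.NumberTheory.DiophantineGeometry.NamedHypothesesProofs
import HarnessLib

/-!
# Helper lemmas for stub_clusterSigns

Kernel bounds and window membership for pair-isolation arguments.
-/

noncomputable section

open Complex Set Filter Topology
open Literature.NumberTheory.LFunctions

namespace StubClusterSignsHelpers

/-! ## Partner zero lemma -/

/-- The partner zero `½-δ+iγ` exists when `½+δ+iγ` is a zero of ζ (functional equation + conjugation). -/
theorem partner_zero_exists {γ δ : ℝ} (hδ : 0 < δ) (hδhalf : δ < 1 / 2)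
    (hz : riemannZeta (1 / 2 + δ + γ * I) = 0) :
    riemannZeta (1 / 2 - δ + γ * I) = 0 := by
  have h0 : (0 : ℝ) < 1 / 2 + δ := by linarith
  have h1 : 1 / 2 + δ < 1 := by linarith
  have hz1 : riemannZeta (1 - (1 / 2 + δ + γ * I)) = 0 :=
    GeneralizedRH.riemannZeta_one_sub_eq_zero hz (by simp; linarith) (by simp; linarith)
  have e2 : (1 - (1 / 2 + δ + γ * I) : ℂ) = (1 / 2 : ℝ) - δ - γ * I := by
    simp only [Complex.ofReal_div, Complex.ofReal_one, Complex.ofReal_ofNat]; ring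
  rw [e2] at hz1
  have e : (1 / 2 - δ + γ * I : ℂ) = starRingEnd ℂ ((1 / 2 : ℝ) - δ - γ * I) := by
    rw [starRingEnd_apply, Complex.star_def]
    simp only [Complex.ofReal_div, Complex.ofReal_one, Complex.ofReal_ofNat,
      map_sub, map_div₀, Complex.conj_ofReal, map_one, Complex.conj_ofNat, map_mul,
      Complex.conj_I, mul_neg]; ring
  rw [e, riemannZeta_conj, hz1, map_zero]

/-! ## Window membership -/

/-- A point `½+σ+iγ` with `|σ| < 1/2` and `γ > 0` is in `zetaZeroBox 0 T` when `ζ(½+σ+iγ) = 0` and `γ ≤ T`. -/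
theorem mem_zetaZeroBox_of_zero_critStrip {σ γ T : ℝ} (hσ0 : -1/2 < σ) (hσ1 : σ < 1/2)
    (hγ : 0 < γ) (hγT : γ ≤ T) (hz : riemannZeta (1 / 2 + σ + γ * I) = 0) :
    (1 / 2 + σ + γ * I : ℂ) ∈ zetaZeroBox 0 T := by
  refine ⟨hz, ?_, ?_, ?_, ?_⟩ <;> simp <;> linarith

/-- The pair zero `½+δ+iγ` is in the window `(γ+δ-1, γ+δ+1]` when `δ < 1/2`. -/
theorem pair_plus_mem_window_plus {γ δ : ℝ} (hγ : 0 < γ) (hδ : 0 < δ) (hδhalf : δ < 1 / 2)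
    (hz : riemannZeta (1 / 2 + δ + γ * I) = 0) :
    (1 / 2 + δ + γ * I : ℂ) ∈ window (γ + δ) := by
  simp only [window, Set.mem_sdiff]
  constructor
  · exact mem_zetaZeroBox_of_zero_critStrip (by linarith) hδhalf hγ (by linarith) hz
  · intro h; have := h.2.2.2.2; simp at this; linarith

/-- The pair zero `½-δ+iγ` is in the window `(γ+δ-1, γ+δ+1]`. -/
theorem pair_minus_mem_window_plus {γ δ : ℝ} (hγ : 0 < γ) (hδ : 0 < δ) (hδhalf : δ < 1 / 2)
    (hz : riemannZeta (1 / 2 - δ + γ * I) = 0) :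
    (1 / 2 - δ + γ * I : ℂ) ∈ window (γ + δ) := by
  simp only [window, Set.mem_sdiff, zetaZeroBox, Set.mem_setOf]
  constructor
  · refine ⟨hz, ?_, ?_, ?_, ?_⟩ <;> simp <;> linarith
  · intro h; have := h.2.2.2.2; simp at this; linarith

/-- The pair zero `½+δ+iγ` is in the window at `t = γ-δ`. -/
theorem pair_plus_mem_window_minus {γ δ : ℝ} (hγ : 0 < γ) (hδ : 0 < δ) (hδhalf : δ < 1 / 2)
    (hz : riemannZeta (1 / 2 + δ + γ * I) = 0) :
    (1 / 2 + δ + γ * I : ℂ) ∈ window (γ - δ) := by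
  simp only [window, Set.mem_sdiff]
  constructor
  · exact mem_zetaZeroBox_of_zero_critStrip (by linarith) hδhalf hγ (by linarith) hz
  · intro h; have := h.2.2.2.2; simp at this; linarith

/-- The pair zero `½-δ+iγ` is in the window at `t = γ-δ`. -/
theorem pair_minus_mem_window_minus {γ δ : ℝ} (hγ : 0 < γ) (hδ : 0 < δ) (hδhalf : δ < 1 / 2)
    (hz : riemannZeta (1 / 2 - δ + γ * I) = 0) :
    (1 / 2 - δ + γ * I : ℂ) ∈ window (γ - δ) := by
  simp only [window, Set.mem_sdiff, zetaZeroBox, Set.mem_setOf]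
  constructor
  · refine ⟨hz, ?_, ?_, ?_, ?_⟩ <;> simp <;> linarith
  · intro h; have := h.2.2.2.2; simp at this; linarith

/-! ## Kernel computations -/

/-- The kernel at `t = γ+δ` for the zero `½+δ+iγ`. -/
theorem kernel_pair_right_plus {γ δ : ℝ} (hδ : 0 < δ) :
    kernel (γ + δ) (1 / 2 + δ + γ * I) = 1 / (2 * δ) - δ / ((3 / 2 - δ) ^ 2 + δ ^ 2) := by
  unfold kernel critPt cmpPt
  have h1 : (1 / 2 + (γ + δ : ℝ) * I : ℂ) - (1 / 2 + δ + γ * I) = -δ + δ * I := by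
    simp only [Complex.ofReal_add]; ring
  have h2 : (2 + (γ + δ : ℝ) * I : ℂ) - (1 / 2 + δ + γ * I) = 3 / 2 - δ + δ * I := by
    simp only [Complex.ofReal_add]; ring
  rw [h1, h2]
  have him1 : (-↑δ + ↑δ * I : ℂ).im = δ := by simp
  have him2 : ((3 : ℂ) / 2 - ↑δ + ↑δ * I).im = δ := by simp
  have hns1 : Complex.normSq (-↑δ + ↑δ * I : ℂ) = 2 * δ ^ 2 := by
    rw [show (-↑δ + ↑δ * I : ℂ) = ((-δ : ℝ) : ℂ) + (δ : ℝ) * I by simp]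
    rw [Complex.normSq_add_mul_I]; ring
  have hns2 : Complex.normSq ((3 : ℂ) / 2 - ↑δ + ↑δ * I) = (3 / 2 - δ) ^ 2 + δ ^ 2 := by
    rw [show ((3 : ℂ) / 2 - ↑δ + ↑δ * I) = ((3 / 2 - δ : ℝ) : ℂ) + (δ : ℝ) * I by simp]
    rw [Complex.normSq_add_mul_I]
  have hd1 : (2 : ℝ) * δ ^ 2 ≠ 0 := by nlinarith
  have hd2 : (3 / 2 - δ) ^ 2 + δ ^ 2 ≠ 0 := by nlinarith [sq_nonneg δ, sq_nonneg (3 / 2 - δ)]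
  rw [one_div, one_div]; simp only [Complex.sub_im]
  rw [Complex.inv_im, Complex.inv_im, him1, him2, hns1, hns2]
  field_simp; ring

/-- Lower bound on kernel for pair zero at `t = γ+δ`. -/
theorem kernel_pair_plus_lower {γ δ : ℝ} (_hγ : 100 ≤ γ) (hδ : 0 < δ) (hδhalf : δ < 1 / 2) :
    1 / (2 * δ) - δ ≤ kernel (γ + δ) (1 / 2 + δ + γ * I) := by
  rw [kernel_pair_right_plus hδ]
  have hden : (3 / 2 - δ) ^ 2 + δ ^ 2 ≥ 1 := by nlinarith [sq_nonneg δ, sq_nonneg (3 / 2 - δ)]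
  have hden_pos : 0 < (3 / 2 - δ) ^ 2 + δ ^ 2 := by nlinarith [sq_nonneg δ, sq_nonneg (3 / 2 - δ)]
  have hdiv : δ / ((3 / 2 - δ) ^ 2 + δ ^ 2) ≤ δ := by rw [div_le_iff₀ hden_pos]; nlinarith
  linarith

/-- The kernel at `t = γ+δ` for the partner zero `½-δ+iγ`. -/
theorem kernel_partner_plus {γ δ : ℝ} (hδ : 0 < δ) :
    kernel (γ + δ) (1 / 2 - δ + γ * I) = 1 / (2 * δ) - δ / ((3 / 2 + δ) ^ 2 + δ ^ 2) := by
  unfold kernel critPt cmpPt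
  have h1 : (1 / 2 + (γ + δ : ℝ) * I : ℂ) - (1 / 2 - δ + γ * I) = δ + δ * I := by
    simp only [Complex.ofReal_add]; ring
  have h2 : (2 + (γ + δ : ℝ) * I : ℂ) - (1 / 2 - δ + γ * I) = 3 / 2 + δ + δ * I := by
    simp only [Complex.ofReal_add]; ring
  rw [h1, h2]
  have him1 : (↑δ + ↑δ * I : ℂ).im = δ := by simp
  have him2 : ((3 : ℂ) / 2 + ↑δ + ↑δ * I).im = δ := by simp
  have hns1 : Complex.normSq (↑δ + ↑δ * I : ℂ) = 2 * δ ^ 2 := by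
    rw [show (↑δ + ↑δ * I : ℂ) = ((δ : ℝ) : ℂ) + (δ : ℝ) * I by simp]
    rw [Complex.normSq_add_mul_I]; ring
  have hns2 : Complex.normSq ((3 : ℂ) / 2 + ↑δ + ↑δ * I) = (3 / 2 + δ) ^ 2 + δ ^ 2 := by
    rw [show ((3 : ℂ) / 2 + ↑δ + ↑δ * I) = ((3 / 2 + δ : ℝ) : ℂ) + (δ : ℝ) * I by simp]
    rw [Complex.normSq_add_mul_I]
  have hd1 : (2 : ℝ) * δ ^ 2 ≠ 0 := by nlinarith
  have hd2 : (3 / 2 + δ) ^ 2 + δ ^ 2 ≠ 0 := by nlinarith [sq_nonneg δ, sq_nonneg (3 / 2 + δ)]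
  rw [one_div, one_div]; simp only [Complex.sub_im]
  rw [Complex.inv_im, Complex.inv_im, him1, him2, hns1, hns2]
  field_simp; ring

/-- Lower bound for partner zero at `t = γ+δ`. -/
theorem kernel_partner_plus_lower {γ δ : ℝ} (_hγ : 100 ≤ γ) (hδ : 0 < δ) (hδhalf : δ < 1 / 2) :
    1 / (2 * δ) - δ ≤ kernel (γ + δ) (1 / 2 - δ + γ * I) := by
  rw [kernel_partner_plus hδ]
  have hden : (3 / 2 + δ) ^ 2 + δ ^ 2 ≥ 1 := by nlinarith [sq_nonneg δ, sq_nonneg (3 / 2 + δ)]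
  have hden_pos : 0 < (3 / 2 + δ) ^ 2 + δ ^ 2 := by nlinarith [sq_nonneg δ, sq_nonneg (3 / 2 + δ)]
  have hdiv : δ / ((3 / 2 + δ) ^ 2 + δ ^ 2) ≤ δ := by rw [div_le_iff₀ hden_pos]; nlinarith
  linarith

/-- The kernel at `t = γ-δ` for the pair zero `½+δ+iγ`. -/
theorem kernel_pair_minus {γ δ : ℝ} (hδ : 0 < δ) :
    kernel (γ - δ) (1 / 2 + δ + γ * I) = -(1 / (2 * δ)) + δ / ((3 / 2 - δ) ^ 2 + δ ^ 2) := by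
  unfold kernel critPt cmpPt
  have h1 : (1 / 2 + (γ - δ : ℝ) * I : ℂ) - (1 / 2 + δ + γ * I) = -δ - δ * I := by
    simp only [Complex.ofReal_sub]; ring
  have h2 : (2 + (γ - δ : ℝ) * I : ℂ) - (1 / 2 + δ + γ * I) = 3 / 2 - δ - δ * I := by
    simp only [Complex.ofReal_sub]; ring
  rw [h1, h2]
  have him1 : (-↑δ - ↑δ * I : ℂ).im = -δ := by simp
  have him2 : ((3 : ℂ) / 2 - ↑δ - ↑δ * I).im = -δ := by simp
  have hns1 : Complex.normSq (-↑δ - ↑δ * I : ℂ) = 2 * δ ^ 2 := by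
    have hre : (-↑δ - ↑δ * I : ℂ).re = -δ := by simp
    have him : (-↑δ - ↑δ * I : ℂ).im = -δ := by simp
    rw [Complex.normSq_apply, hre, him]; ring
  have hns2 : Complex.normSq ((3 : ℂ) / 2 - ↑δ - ↑δ * I) = (3 / 2 - δ) ^ 2 + δ ^ 2 := by
    have hre : ((3 : ℂ) / 2 - ↑δ - ↑δ * I).re = 3 / 2 - δ := by simp
    have him : ((3 : ℂ) / 2 - ↑δ - ↑δ * I).im = -δ := by simp
    rw [Complex.normSq_apply, hre, him]; ring
  have hd1 : (2 : ℝ) * δ ^ 2 ≠ 0 := by nlinarith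
  have hd2 : (3 / 2 - δ) ^ 2 + δ ^ 2 ≠ 0 := by nlinarith [sq_nonneg δ, sq_nonneg (3 / 2 - δ)]
  rw [one_div, one_div]; simp only [Complex.sub_im]
  rw [Complex.inv_im, Complex.inv_im, him1, him2, hns1, hns2]
  field_simp; ring

/-- Upper bound on kernel for pair zero at `t = γ-δ`. -/
theorem kernel_pair_plus_minus_upper {γ δ : ℝ} (_hγ : 100 ≤ γ) (hδ : 0 < δ) (hδhalf : δ < 1 / 2) :
    kernel (γ - δ) (1 / 2 + δ + γ * I) ≤ -(1 / (2 * δ)) + δ := by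
  rw [kernel_pair_minus hδ]
  have hden_pos : 0 < (3 / 2 - δ) ^ 2 + δ ^ 2 := by nlinarith [sq_nonneg δ, sq_nonneg (3 / 2 - δ)]
  have hdiv : δ / ((3 / 2 - δ) ^ 2 + δ ^ 2) ≤ δ := by rw [div_le_iff₀ hden_pos]; nlinarith
  linarith

/-- The kernel at `t = γ-δ` for the partner zero `½-δ+iγ`. -/
theorem kernel_partner_minus {γ δ : ℝ} (hδ : 0 < δ) :
    kernel (γ - δ) (1 / 2 - δ + γ * I) = -(1 / (2 * δ)) + δ / ((3 / 2 + δ) ^ 2 + δ ^ 2) := by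
  unfold kernel critPt cmpPt
  have h1 : (1 / 2 + (γ - δ : ℝ) * I : ℂ) - (1 / 2 - δ + γ * I) = δ - δ * I := by
    simp only [Complex.ofReal_sub]; ring
  have h2 : (2 + (γ - δ : ℝ) * I : ℂ) - (1 / 2 - δ + γ * I) = 3 / 2 + δ - δ * I := by
    simp only [Complex.ofReal_sub]; ring
  rw [h1, h2]
  have him1 : (↑δ - ↑δ * I : ℂ).im = -δ := by simp
  have him2 : ((3 : ℂ) / 2 + ↑δ - ↑δ * I).im = -δ := by simp
  have hns1 : Complex.normSq (↑δ - ↑δ * I : ℂ) = 2 * δ ^ 2 := by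
    have hre : (↑δ - ↑δ * I : ℂ).re = δ := by simp
    have him : (↑δ - ↑δ * I : ℂ).im = -δ := by simp
    rw [Complex.normSq_apply, hre, him]; ring
  have hns2 : Complex.normSq ((3 : ℂ) / 2 + ↑δ - ↑δ * I) = (3 / 2 + δ) ^ 2 + δ ^ 2 := by
    have hre : ((3 : ℂ) / 2 + ↑δ - ↑δ * I).re = 3 / 2 + δ := by simp
    have him : ((3 : ℂ) / 2 + ↑δ - ↑δ * I).im = -δ := by simp
    rw [Complex.normSq_apply, hre, him]; ring
  have hd1 : (2 : ℝ) * δ ^ 2 ≠ 0 := by nlinarith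
  have hd2 : (3 / 2 + δ) ^ 2 + δ ^ 2 ≠ 0 := by nlinarith [sq_nonneg δ, sq_nonneg (3 / 2 + δ)]
  rw [one_div, one_div]; simp only [Complex.sub_im]
  rw [Complex.inv_im, Complex.inv_im, him1, him2, hns1, hns2]
  field_simp; ring

/-- Upper bound for partner zero at `t = γ-δ`. -/
theorem kernel_partner_minus_upper {γ δ : ℝ} (_hγ : 100 ≤ γ) (hδ : 0 < δ) (hδhalf : δ < 1 / 2) :
    kernel (γ - δ) (1 / 2 - δ + γ * I) ≤ -(1 / (2 * δ)) + δ := by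
  rw [kernel_partner_minus hδ]
  have hden_pos : 0 < (3 / 2 + δ) ^ 2 + δ ^ 2 := by nlinarith [sq_nonneg δ, sq_nonneg (3 / 2 + δ)]
  have hdiv : δ / ((3 / 2 + δ) ^ 2 + δ ^ 2) ≤ δ := by rw [div_le_iff₀ hden_pos]; nlinarith
  linarith

/-- Upper bound on |kernel| for non-pair zeros with isolation radius r. -/
theorem abs_kernel_nonpair_le {γ δ r t : ℝ} {ρ : ℂ}
    (hδ : 0 < δ) (hr : 2 * δ ≤ r) (hρim : r ≤ |ρ.im - γ|)
    (hρre0 : 0 < ρ.re) (hρre1 : ρ.re < 1) (ht : |t - γ| ≤ δ) :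
    |kernel t ρ| ≤ 1 / (r - δ) + 1 / 2 := by
  have hrδ : 0 < r - δ := by linarith
  have hdist : r - δ ≤ |t - ρ.im| := by
    have h1 : |ρ.im - γ| ≤ |ρ.im - t| + |t - γ| := abs_sub_le _ _ _
    have h2 : |ρ.im - t| = |t - ρ.im| := abs_sub_comm _ _
    linarith
  have hdistne : t - ρ.im ≠ 0 := fun h => by simp [h] at hdist; linarith
  have hcrit_re : (1 / 2 + (t : ℂ) * I - ρ).re = 1 / 2 - ρ.re := by simp
  have hcrit_im : (1 / 2 + (t : ℂ) * I - ρ).im = t - ρ.im := by simp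
  have hcmp_re : (2 + (t : ℂ) * I - ρ).re = 2 - ρ.re := by simp
  have hcmp_im : (2 + (t : ℂ) * I - ρ).im = t - ρ.im := by simp
  have hcmp_re_ge : 1 ≤ |2 - ρ.re| := by rw [abs_of_pos (by linarith : 0 < 2 - ρ.re)]; linarith
  have him_inv_crit : (1 / (1 / 2 + (t : ℂ) * I - ρ)).im =
      -(t - ρ.im) / ((1 / 2 - ρ.re) ^ 2 + (t - ρ.im) ^ 2) := by
    rw [one_div, Complex.inv_im]
    congr 1
    · rw [← hcrit_im]
    · rw [Complex.normSq_apply, hcrit_re, hcrit_im]; ring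
  have him_inv_cmp : (1 / (2 + (t : ℂ) * I - ρ)).im =
      -(t - ρ.im) / ((2 - ρ.re) ^ 2 + (t - ρ.im) ^ 2) := by
    rw [one_div, Complex.inv_im]
    congr 1
    · rw [← hcmp_im]
    · rw [Complex.normSq_apply, hcmp_re, hcmp_im]; ring
  have hker : kernel t ρ = (t - ρ.im) / ((1 / 2 - ρ.re) ^ 2 + (t - ρ.im) ^ 2) -
                          (t - ρ.im) / ((2 - ρ.re) ^ 2 + (t - ρ.im) ^ 2) := by
    unfold kernel critPt cmpPt; simp only [Complex.sub_im]
    rw [him_inv_crit, him_inv_cmp]; ring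
  rw [hker]
  have hden1 : 0 < (1 / 2 - ρ.re) ^ 2 + (t - ρ.im) ^ 2 := by
    nlinarith [sq_nonneg (1 / 2 - ρ.re), sq_nonneg (t - ρ.im), sq_pos_of_ne_zero hdistne]
  have hden2 : 0 < (2 - ρ.re) ^ 2 + (t - ρ.im) ^ 2 := by
    nlinarith [sq_nonneg (2 - ρ.re), sq_nonneg (t - ρ.im), sq_pos_of_ne_zero hdistne]
  have h1 : |(t - ρ.im) / ((1 / 2 - ρ.re) ^ 2 + (t - ρ.im) ^ 2)| =
      |t - ρ.im| / ((1 / 2 - ρ.re) ^ 2 + (t - ρ.im) ^ 2) := by rw [abs_div, abs_of_pos hden1]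
  have h2 : |(t - ρ.im) / ((2 - ρ.re) ^ 2 + (t - ρ.im) ^ 2)| =
      |t - ρ.im| / ((2 - ρ.re) ^ 2 + (t - ρ.im) ^ 2) := by rw [abs_div, abs_of_pos hden2]
  have hb1 : |t - ρ.im| / ((1 / 2 - ρ.re) ^ 2 + (t - ρ.im) ^ 2) ≤ 1 / |t - ρ.im| := by
    rw [div_le_div_iff₀ hden1 (by positivity)]
    calc 1 * ((1 / 2 - ρ.re) ^ 2 + (t - ρ.im) ^ 2) ≥ (t - ρ.im) ^ 2 := by nlinarith [sq_nonneg (1 / 2 - ρ.re)]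
      _ = |t - ρ.im| ^ 2 := by rw [sq_abs]
      _ = |t - ρ.im| * |t - ρ.im| := by ring
  have hb1' : 1 / |t - ρ.im| ≤ 1 / (r - δ) := by
    rw [div_le_div_iff₀ (by positivity) hrδ]; linarith
  have hb2 : |t - ρ.im| / ((2 - ρ.re) ^ 2 + (t - ρ.im) ^ 2) ≤ 1 / 2 := by
    have h : 2 * |t - ρ.im| ≤ (2 - ρ.re) ^ 2 + (t - ρ.im) ^ 2 := by
      have := sq_nonneg (|2 - ρ.re| - |t - ρ.im|)
      calc (2 - ρ.re) ^ 2 + (t - ρ.im) ^ 2 = |2 - ρ.re| ^ 2 + |t - ρ.im| ^ 2 := by rw [sq_abs, sq_abs]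
        _ ≥ 2 * |2 - ρ.re| * |t - ρ.im| := by nlinarith
        _ ≥ 2 * 1 * |t - ρ.im| := by nlinarith
        _ = 2 * |t - ρ.im| := by ring
    rw [div_le_iff₀ (by positivity)]; linarith
  calc |_| ≤ |_| + |_| := abs_sub _ _
    _ = _ + _ := by rw [h1, h2]
    _ ≤ 1 / |t - ρ.im| + 1 / 2 := by linarith [hb1, hb2]
    _ ≤ 1 / (r - δ) + 1 / 2 := by linarith [hb1']

end StubClusterSignsHelpers

end
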